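import Summits.Ventures.PackingBounds.Energy.NewtonCertificateDeficit
import Summits.Ventures.PackingBounds.Energy.CircleEnergyLP

/-!
# The deficit inequality for Newton-form certificates on the circle `S¹` (Chebyshev form)

Framing: lottery ticket; floor = certified bounds/negative ranges. Venture `PackingBounds` (cell
`pub-packcert`, seat `pub-packcert-energy`). The `n = 2` companion of `NewtonCert.energy_deficit`
(`NewtonCertificateDeficit.lean`), with the Chebyshev kernels `T_k` of `CircleEnergyLP` in place of the
Gegenbauer polynomials: under the hypotheses of `NewtonCert.energy_ge_circle` and `k ≥ D`, every `N`-point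
configuration `C ⊂ S¹` satisfies
`N Σ_{i<M} m_i v_i^k + Σ_{x ≠ y} (1+⟨x,y⟩)^{k-D} ω_D(1+⟨x,y⟩) ≤ Σ_{x ≠ y} (1+⟨x,y⟩)^k`.
Used for the rigidity (uniqueness of the ground state) of the regular polygons.

## References
* H. Cohn, A. Kumar, *Universally optimal distribution of points on spheres*, J. Amer. Math. Soc.
  20 (2007) 99–148, Thm. 1.2, Prop. 4.1. [`CohnKumar2006`]
-/

noncomputable section

namespace Summit.Ventures.PackingBounds.Energy

open Finset Polynomial.Chebyshev

namespace NewtonCert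

open scoped Classical in
/-- **Deficit inequality for Newton-form certificates on `S¹`.** Under the hypotheses of
`NewtonCert.energy_ge_circle` and `k ≥ D`, every `N`-point configuration `C ⊂ S¹` satisfies
`N Σ_{i<M} m_i v_i^k + Σ_{x ≠ y} (1+⟨x,y⟩)^{k-D} ω_D(1+⟨x,y⟩) ≤ Σ_{x ≠ y} (1+⟨x,y⟩)^k`.
[cite: CohnKumar2006, Theorem 1.2 and Proposition 4.1] -/
theorem energy_deficit_circle (D : ℕ) (hD : 1 ≤ D) (v : ℕ → ℝ) (hv : ∀ i, 0 ≤ v i)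
    (hωD : ∀ u : ℝ, 0 ≤ u → 0 ≤ ∏ i ∈ range D, (u - v i))
    (G : ℕ → ℕ → ℝ) (hG : ∀ j i, 0 ≤ G j i)
    (hGid : ∀ j < D, ∀ t : ℝ,
      ∏ i ∈ range j, (1 + t - v i) = ∑ i ∈ range D, G j i * (T ℝ i).eval t)
    (N M : ℕ) (hM : M ≤ D) (mult : ℕ → ℝ)
    (hdesign : ∀ j < D, (N : ℝ) * G j 0 =
      ∏ i ∈ range j, (2 - v i) + ∑ i ∈ range M, mult i * ∏ i' ∈ range j, (v i - v i'))
    (k : ℕ) (hk : D ≤ k) (C : Finset (EuclideanSpace ℝ (Fin 2))) (h1 : ∀ x ∈ C, ‖x‖ = 1)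
    (hN : C.card = N) :
    (N : ℝ) * ∑ i ∈ range M, mult i * v i ^ k +
        ∑ x ∈ C, ∑ y ∈ C.erase x,
          (1 + inner ℝ x y) ^ (k - D) * ∏ i ∈ range D, (1 + inner ℝ x y - v i) ≤
      ∑ x ∈ C, ∑ y ∈ C.erase x, (1 + inner ℝ x y) ^ k := by
  obtain ⟨c, r, hc, hr, hexp, -, -, hrem⟩ := newton_exists_strict v hv D hD k
  -- Chebyshev coefficients of the certificate `h_k = Σ_j c_j ω_j(1+t)`
  set α : ℕ → ℝ := fun i => ∑ j ∈ range D, c j * G j i with hαdef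
  have hα : ∀ i, 0 ≤ α i := fun i =>
    Finset.sum_nonneg fun j _ => mul_nonneg (hc j) (hG j i)
  have hswap : ∀ t : ℝ, ∑ i ∈ range D, α i * (T ℝ i).eval t =
      ∑ j ∈ range D, c j * ∏ i ∈ range j, (1 + t - v i) := by
    intro t
    calc ∑ i ∈ range D, α i * (T ℝ i).eval t
          = ∑ i ∈ range D, ∑ j ∈ range D, c j * G j i * (T ℝ i).eval t := by
            refine Finset.sum_congr rfl fun i _ => ?_
            rw [hαdef, Finset.sum_mul]
      _ = ∑ j ∈ range D, ∑ i ∈ range D, c j * G j i * (T ℝ i).eval t := Finset.sum_comm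
      _ = ∑ j ∈ range D, c j * ∏ i ∈ range j, (1 + t - v i) := by
            refine Finset.sum_congr rfl fun j hj => ?_
            rw [hGid j (Finset.mem_range.1 hj) t, Finset.mul_sum]
            exact Finset.sum_congr rfl fun i _ => by ring
  have hD' : D - 1 + 1 = D := Nat.sub_add_cancel hD
  -- the LP bound applied to the certificate itself
  set h : ℝ → ℝ := fun t => ∑ j ∈ range D, c j * ∏ i ∈ range j, (1 + t - v i) with hhdef
  have hH : ∀ t : ℝ, -1 ≤ t → t < 1 →
      ∑ i ∈ range (D - 1 + 1), α i * (T ℝ i).eval t ≤ h t := by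
    intro t _ _
    rw [hD', hswap t]
  have key := CircleLP.energy_ge (D - 1) α hα h hH C h1
  have h2 : ∑ j ∈ range D, c j * ∏ i ∈ range j, (1 + 1 - v i) =
      ∑ j ∈ range D, c j * ∏ i ∈ range j, ((2 : ℝ) - v i) :=
    Finset.sum_congr rfl fun j _ => by
      rw [Finset.prod_congr rfl fun i _ => by rw [show (1 : ℝ) + 1 = 2 by norm_num]]
  have hα0 : α 0 = ∑ j ∈ range D, c j * G j 0 := by rw [hαdef]
  rw [hD', hN, hswap 1, h2, hα0] at key
  -- evaluate the bound: `N² α_0 - N h_k(1) = N Σ_i m_i v_i^k`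
  have hval : ∀ j ∈ range D, (N : ℝ) * G j 0 - ∏ i ∈ range j, (2 - v i) =
      ∑ i ∈ range M, mult i * ∏ i' ∈ range j, (v i - v i') := fun j hj => by
    rw [hdesign j (Finset.mem_range.1 hj)]; ring
  have hnode : ∀ i ∈ range M, ∑ j ∈ range D, c j * ∏ i' ∈ range j, (v i - v i') = v i ^ k := by
    intro i hi
    have h := hexp (v i)
    rw [omega_node v (lt_of_lt_of_le (Finset.mem_range.1 hi) hM), mul_zero, add_zero] at h
    exact h.symm
  have hbound : (N : ℝ) * ∑ i ∈ range M, mult i * v i ^ k =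
      (N : ℝ) ^ 2 * ∑ j ∈ range D, c j * G j 0 -
          (N : ℝ) * ∑ j ∈ range D, c j * ∏ i ∈ range j, (2 - v i) := by
    calc (N : ℝ) * ∑ i ∈ range M, mult i * v i ^ k
          = (N : ℝ) * ∑ i ∈ range M, mult i *
              ∑ j ∈ range D, c j * ∏ i' ∈ range j, (v i - v i') := by
            congr 1; exact Finset.sum_congr rfl fun i hi => by rw [hnode i hi]
      _ = (N : ℝ) * ∑ j ∈ range D, c j *
              ∑ i ∈ range M, mult i * ∏ i' ∈ range j, (v i - v i') := by
            congr 1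
            rw [Finset.sum_congr rfl fun i _ => Finset.mul_sum (range D) _ (mult i), Finset.sum_comm]
            refine Finset.sum_congr rfl fun j _ => ?_
            rw [Finset.mul_sum]
            exact Finset.sum_congr rfl fun i _ => by ring
      _ = (N : ℝ) * ∑ j ∈ range D, c j * ((N : ℝ) * G j 0 - ∏ i ∈ range j, (2 - v i)) := by
            congr 1; exact Finset.sum_congr rfl fun j hj => by rw [hval j hj]
      _ = (N : ℝ) ^ 2 * ∑ j ∈ range D, c j * G j 0 -
            (N : ℝ) * ∑ j ∈ range D, c j * ∏ i ∈ range j, (2 - v i) := by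
            rw [Finset.mul_sum, Finset.mul_sum, Finset.mul_sum, ← Finset.sum_sub_distrib]
            exact Finset.sum_congr rfl fun j _ => by ring
  -- the energy splits as `E_h + Σ r ω_D`, and `r(u) ω_D(u) ≥ u^{k-D} ω_D(u)` termwise
  have hsplit : ∑ x ∈ C, ∑ y ∈ C.erase x, (1 + inner ℝ x y) ^ k =
      ∑ x ∈ C, ∑ y ∈ C.erase x, h (inner ℝ x y) +
        ∑ x ∈ C, ∑ y ∈ C.erase x,
          r (1 + inner ℝ x y) * ∏ i ∈ range D, (1 + inner ℝ x y - v i) := by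
    rw [← Finset.sum_add_distrib]
    refine Finset.sum_congr rfl fun x _ => ?_
    rw [← Finset.sum_add_distrib]
    refine Finset.sum_congr rfl fun y _ => ?_
    rw [hexp (1 + inner ℝ x y)]
  have hterm : ∀ x ∈ C, ∀ y ∈ C.erase x,
      (1 + inner ℝ x y) ^ (k - D) * ∏ i ∈ range D, (1 + inner ℝ x y - v i) ≤
        r (1 + inner ℝ x y) * ∏ i ∈ range D, (1 + inner ℝ x y - v i) := by
    intro x hx y hy
    have hb := inner_mem_Ico_of_norm_eq_one (h1 x hx) (h1 y (Finset.mem_of_mem_erase hy))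
      (Finset.ne_of_mem_erase hy).symm
    have hu : (0 : ℝ) ≤ 1 + inner ℝ x y := by linarith [hb.1]
    exact mul_le_mul_of_nonneg_right (hrem hk _ hu) (hωD _ hu)
  have hsum_le : ∑ x ∈ C, ∑ y ∈ C.erase x,
      (1 + inner ℝ x y) ^ (k - D) * ∏ i ∈ range D, (1 + inner ℝ x y - v i) ≤
      ∑ x ∈ C, ∑ y ∈ C.erase x,
        r (1 + inner ℝ x y) * ∏ i ∈ range D, (1 + inner ℝ x y - v i) :=
    Finset.sum_le_sum fun x hx => Finset.sum_le_sum fun y hy => hterm x hx y hy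
  rw [hsplit, hbound]
  linarith

end NewtonCert

end Summit.Ventures.PackingBounds.Energy

end
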